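import Mathlib
import HarnessLib

/-!
# Primitive vectors of `ℤ⁴` under `Sp₄(ℤ)`: transitivity and the gcd decomposition

Stage 5a of the bottom-up proof of Siegel's volume formula
`Literature.NumberTheory.ModularForms.Siegel1943_vol_F2` (`vol(F₂) = π³/270`; [cite: Klingen1990,
Ch. I §3, closing remark]). In the unfolding of `∫_{F₂} (θ_Z(s) - 1) dv` (theta function of
`SiegelThetaGenusTwo.lean`) the sum over `v ∈ ℤ⁴ ∖ 0` is rearranged as `Σ_{k ≥ 1} Σ_{w primitive}`
and the primitive vectors are identified with `Sp₄(ℤ)/Stab(e)`. This file supplies the two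
purely arithmetic inputs, PROVED (no named facts):

* `exists_sp4Z_mulVec_eq` — **`Sp₄(ℤ)` acts transitively on primitive vectors of `ℤ⁴`**: every
  `w = (a; b)` with `gcd(a₀, b₀, a₁, b₁) = 1` is moved to `e = (0, 1; 0, 0)` by an explicit product
  `R(U) · M^{(2)} · M^{(1)}` of Klingen's generators (I.3 Prop. 6): the embedded `SL₂(ℤ)`'s
  `emb0`, `emb1` (acting on the coordinate pairs `(a_i, b_i)`, moving each to `(gcd, 0)` by Bézout,
  `exists_sl2_to_gcd`) and a rotation `rot = (U 0; 0 U⁻ᵀ)` moving the primitive `(g₀, g₁; 0, 0)`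
  to `e` (`exists_sl2_to_e2`); membership in `Matrix.symplecticGroup (Fin 2) ℤ` is checked with
  `Matrix.SymplecticGroup.fromBlocks_mem_iff`.
* `vgcd`, `primPart`, `Prim`, `gcdEquiv : ℕ × Prim ≃ {v ≠ 0}` (`(n, w) ↦ (n+1) w`) and
  `tsum_ne_zero_eq_tsum_prim`, `tsum_eq_zero_add_tsum_ne_zero` — **the gcd decomposition**
  `Σ_{v ≠ 0} F(v) = Σ_{n} Σ_{w primitive} F((n+1) w)` in `ℝ≥0∞`.

## References

* H. Klingen, *Introductory Lectures on Siegel Modular Forms*, CUP 1990, Ch. I §3 Prop. 6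
  (generators `U`, `M^{(ν)}` of `Γ_n`). [Klingen1990]
-/

namespace Literature.NumberTheory.ModularForms.Sp4Covolume

open Matrix

/-- The `SL₂` embedded on the coordinates `(a₀, b₀)`. [folklore] -/
def emb0 (α β γ δ : ℤ) : Matrix (Fin 2 ⊕ Fin 2) (Fin 2 ⊕ Fin 2) ℤ :=
  fromBlocks !![α, 0; 0, 1] !![β, 0; 0, 0] !![γ, 0; 0, 0] !![δ, 0; 0, 1]

/-- The `SL₂` embedded on the coordinates `(a₁, b₁)`. [folklore] -/
def emb1 (α β γ δ : ℤ) : Matrix (Fin 2 ⊕ Fin 2) (Fin 2 ⊕ Fin 2) ℤ :=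
  fromBlocks !![1, 0; 0, α] !![0, 0; 0, β] !![0, 0; 0, γ] !![1, 0; 0, δ]

/-- `emb0` is symplectic when `αδ - βγ = 1`. [cite: Klingen1990, Ch. I §3 Prop. 6 (the embeddings `M^{(ν)}`)] -/
theorem emb0_mem {α β γ δ : ℤ} (h : α * δ - β * γ = 1) : emb0 α β γ δ ∈ Matrix.symplecticGroup (Fin 2) ℤ := by
  rw [emb0, SymplecticGroup.fromBlocks_mem_iff]
  refine ⟨?_, ?_, ?_⟩ <;> (ext i j; fin_cases i <;> fin_cases j <;>
    simp [Matrix.mul_apply, Fin.sum_univ_two]) <;> linarith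

/-- `emb1` is symplectic when `αδ - βγ = 1`. [cite: Klingen1990, Ch. I §3 Prop. 6 (the embeddings `M^{(ν)}`)] -/
theorem emb1_mem {α β γ δ : ℤ} (h : α * δ - β * γ = 1) : emb1 α β γ δ ∈ Matrix.symplecticGroup (Fin 2) ℤ := by
  rw [emb1, SymplecticGroup.fromBlocks_mem_iff]
  refine ⟨?_, ?_, ?_⟩ <;> (ext i j; fin_cases i <;> fin_cases j <;>
    simp [Matrix.mul_apply, Fin.sum_univ_two]) <;> linarith

/-- The rotation `R(U) = (U 0; 0 U⁻ᵀ)` for `U = (p q; r s) ∈ SL₂(ℤ)`, `U⁻ᵀ = (s -r; -q p)`. [folklore] -/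
def rot (p q r s : ℤ) : Matrix (Fin 2 ⊕ Fin 2) (Fin 2 ⊕ Fin 2) ℤ :=
  fromBlocks !![p, q; r, s] 0 0 !![s, -r; -q, p]

/-- `rot` is symplectic when `ps - qr = 1`. [cite: Klingen1990, Ch. I §3 Prop. 6 (the subgroup `U`)] -/
theorem rot_mem {p q r s : ℤ} (h : p * s - q * r = 1) : rot p q r s ∈ Matrix.symplecticGroup (Fin 2) ℤ := by
  rw [rot, SymplecticGroup.fromBlocks_mem_iff]
  refine ⟨by simp, by simp, ?_⟩
  rw [Matrix.transpose_zero, Matrix.zero_mul, sub_zero]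
  ext i j
  fin_cases i <;> fin_cases j <;> simp [Matrix.mul_apply, Fin.sum_univ_two] <;> linarith

/-- The base vector `e` (`a = (0,1)`, `b = 0`). [folklore] -/
def e0 : Fin 2 ⊕ Fin 2 → ℤ := Pi.single (Sum.inl 1) 1

/-- Action of `emb0` on `(a; b)`. [folklore] -/
theorem emb0_mulVec (α β γ δ : ℤ) (a b : Fin 2 → ℤ) :
    emb0 α β γ δ *ᵥ Sum.elim a b =
      Sum.elim ![α * a 0 + β * b 0, a 1] ![γ * a 0 + δ * b 0, b 1] := by
  rw [emb0, fromBlocks_mulVec]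
  ext (j | j) <;> fin_cases j <;> simp [dotProduct, Fin.sum_univ_two]

/-- Action of `emb1` on `(a; b)`. [folklore] -/
theorem emb1_mulVec (α β γ δ : ℤ) (a b : Fin 2 → ℤ) :
    emb1 α β γ δ *ᵥ Sum.elim a b =
      Sum.elim ![a 0, α * a 1 + β * b 1] ![b 0, γ * a 1 + δ * b 1] := by
  rw [emb1, fromBlocks_mulVec]
  ext (j | j) <;> fin_cases j <;> simp [dotProduct, Fin.sum_univ_two]

/-- Action of `rot` on `(a; b)`. [folklore] -/
theorem rot_mulVec (p q r s : ℤ) (a b : Fin 2 → ℤ) :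
    rot p q r s *ᵥ Sum.elim a b =
      Sum.elim ![p * a 0 + q * a 1, r * a 0 + s * a 1] ![s * b 0 - r * b 1, -q * b 0 + p * b 1] := by
  rw [rot, fromBlocks_mulVec]
  ext (j | j) <;> fin_cases j <;> simp [dotProduct, Fin.sum_univ_two]
  ring

/-- A pair `(u, v)` is moved to `(gcd, 0)` by an `SL₂(ℤ)` matrix. [folklore] -/
theorem exists_sl2_to_gcd (u v : ℤ) :
    ∃ α β γ δ : ℤ, α * δ - β * γ = 1 ∧ α * u + β * v = (Int.gcd u v : ℤ) ∧ γ * u + δ * v = 0 := by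
  by_cases h0 : u = 0 ∧ v = 0
  · obtain ⟨rfl, rfl⟩ := h0
    exact ⟨1, 0, 0, 1, by norm_num, by simp, by simp⟩
  · set g : ℤ := (Int.gcd u v : ℤ) with hg
    have hgpos : 0 < g := by
      rw [hg]; exact_mod_cast Int.gcd_pos_iff.2 (by tauto)
    set A := Int.gcdA u v with hA
    set B := Int.gcdB u v with hB
    have hb : u * A + v * B = g := (Int.gcd_eq_gcd_ab u v).symm
    obtain ⟨p, hp⟩ : g ∣ u := Int.gcd_dvd_left u v
    obtain ⟨q, hq⟩ : g ∣ v := Int.gcd_dvd_right u v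
    have h1 : A * p + B * q = 1 := by
      have : g * (A * p + B * q) = g * 1 := by
        rw [mul_one]
        calc g * (A * p + B * q) = g * p * A + g * q * B := by ring
          _ = u * A + v * B := by rw [hp, hq]
          _ = g := hb
      exact mul_left_cancel₀ hgpos.ne' this
    refine ⟨A, B, -q, p, by linarith, by rw [← hb]; ring, by rw [hp, hq]; ring⟩

/-- A coprime pair `(u, v)` is moved to `(0, 1)` by an `SL₂(ℤ)` matrix. [folklore] -/
theorem exists_sl2_to_e2 {u v : ℤ} (h : Int.gcd u v = 1) :
    ∃ p q r s : ℤ, p * s - q * r = 1 ∧ p * u + q * v = 0 ∧ r * u + s * v = 1 := by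
  have hb : u * Int.gcdA u v + v * Int.gcdB u v = 1 := by
    rw [← Int.gcd_eq_gcd_ab u v, h]; rfl
  refine ⟨v, -u, Int.gcdA u v, Int.gcdB u v, ?_, by ring, by rw [← hb]; ring⟩
  linarith [hb]

/-- **`Sp₄(ℤ)` is transitive on primitive vectors**: every primitive `w = (a; b) ∈ ℤ⁴` is moved to
`e = (0,1;0,0)` by some `γ ∈ Sp₄(ℤ)`. [folklore] -/
theorem exists_sp4Z_mulVec_eq (a b : Fin 2 → ℤ)
    (hprim : Int.gcd (Int.gcd (a 0) (b 0) : ℤ) (Int.gcd (a 1) (b 1) : ℤ) = 1) :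
    ∃ γ : Matrix (Fin 2 ⊕ Fin 2) (Fin 2 ⊕ Fin 2) ℤ, γ ∈ Matrix.symplecticGroup (Fin 2) ℤ ∧ γ *ᵥ Sum.elim a b = e0 := by
  obtain ⟨α₀, β₀, γ₀, δ₀, hd₀, h₀, h₀'⟩ := exists_sl2_to_gcd (a 0) (b 0)
  obtain ⟨α₁, β₁, γ₁, δ₁, hd₁, h₁, h₁'⟩ := exists_sl2_to_gcd (a 1) (b 1)
  obtain ⟨p, q, r, s, hd, hpq, hrs⟩ := exists_sl2_to_e2 hprim
  refine ⟨rot p q r s * emb1 α₁ β₁ γ₁ δ₁ * emb0 α₀ β₀ γ₀ δ₀,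
    Submonoid.mul_mem _ (Submonoid.mul_mem _ (rot_mem hd) (emb1_mem hd₁)) (emb0_mem hd₀), ?_⟩
  rw [← mulVec_mulVec, ← mulVec_mulVec, emb0_mulVec, emb1_mulVec, rot_mulVec]
  ext (j | j) <;> fin_cases j <;> simp [e0, h₀, h₀', h₁, h₁', hpq, hrs]

/-- gcd of the four entries (grouped as `(a₀,b₀)`, `(a₁,b₁)`). [folklore] -/
def vgcd (v : Fin 2 ⊕ Fin 2 → ℤ) : ℕ :=
  Int.gcd (Int.gcd (v (Sum.inl 0)) (v (Sum.inr 0))) (Int.gcd (v (Sum.inl 1)) (v (Sum.inr 1)))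

/-- `vgcd v` divides every entry. [folklore] -/
theorem vgcd_dvd (v : Fin 2 ⊕ Fin 2 → ℤ) (i : Fin 2 ⊕ Fin 2) : (vgcd v : ℤ) ∣ v i := by
  unfold vgcd
  set g₀ : ℤ := (Int.gcd (v (Sum.inl 0)) (v (Sum.inr 0)) : ℤ)
  set g₁ : ℤ := (Int.gcd (v (Sum.inl 1)) (v (Sum.inr 1)) : ℤ)
  have h0 : (Int.gcd g₀ g₁ : ℤ) ∣ g₀ := Int.gcd_dvd_left _ _
  have h1 : (Int.gcd g₀ g₁ : ℤ) ∣ g₁ := Int.gcd_dvd_right _ _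
  rcases i with i | i <;> fin_cases i
  · exact h0.trans (Int.gcd_dvd_left _ _)
  · exact h1.trans (Int.gcd_dvd_left _ _)
  · exact h0.trans (Int.gcd_dvd_right _ _)
  · exact h1.trans (Int.gcd_dvd_right _ _)

/-- `vgcd v = 0 ↔ v = 0`. [folklore] -/
theorem vgcd_eq_zero_iff (v : Fin 2 ⊕ Fin 2 → ℤ) : vgcd v = 0 ↔ v = 0 := by
  constructor
  · intro h
    ext i
    have := vgcd_dvd v i
    rw [h, Nat.cast_zero, zero_dvd_iff] at this
    exact this
  · rintro rfl
    simp [vgcd]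

/-- `vgcd (k • w) = k · vgcd w`. [folklore] -/
theorem vgcd_smul (k : ℕ) (w : Fin 2 ⊕ Fin 2 → ℤ) : vgcd ((k : ℤ) • w) = k * vgcd w := by
  unfold vgcd
  simp only [Pi.smul_apply, smul_eq_mul, Int.gcd_mul_left, Int.natAbs_natCast]
  rw [Int.gcd_natCast_natCast, Int.gcd_natCast_natCast, Nat.gcd_mul_left]

/-- The primitive part `v / vgcd v`. [folklore] -/
def primPart (v : Fin 2 ⊕ Fin 2 → ℤ) : Fin 2 ⊕ Fin 2 → ℤ := fun i => v i / vgcd v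

/-- `v = vgcd v • primPart v`. [folklore] -/
theorem vgcd_smul_primPart (v : Fin 2 ⊕ Fin 2 → ℤ) : ((vgcd v : ℕ) : ℤ) • primPart v = v := by
  ext i
  simp only [primPart, Pi.smul_apply, smul_eq_mul]
  exact Int.mul_ediv_cancel' (vgcd_dvd v i)

/-- The primitive part is primitive. [folklore] -/
theorem vgcd_primPart {v : Fin 2 ⊕ Fin 2 → ℤ} (hv : v ≠ 0) : vgcd (primPart v) = 1 := by
  have h := vgcd_smul (vgcd v) (primPart v)
  rw [vgcd_smul_primPart] at h
  have hg : vgcd v ≠ 0 := fun h0 => hv ((vgcd_eq_zero_iff v).1 h0)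
  have : vgcd v * 1 = vgcd v * vgcd (primPart v) := by rw [mul_one]; exact h
  exact (Nat.eq_of_mul_eq_mul_left (Nat.pos_of_ne_zero hg) this).symm

/-- Primitive vectors. [folklore] -/
def Prim : Set (Fin 2 ⊕ Fin 2 → ℤ) := {w | vgcd w = 1}

/-- **The gcd decomposition**: `ℕ × Prim ≃ ℤ⁴ ∖ {0}`, `(n, w) ↦ (n + 1) w`. [folklore] -/
def gcdEquiv : ℕ × Prim ≃ {v : Fin 2 ⊕ Fin 2 → ℤ // v ≠ 0} where
  toFun p := ⟨((p.1 + 1 : ℕ) : ℤ) • (p.2 : Fin 2 ⊕ Fin 2 → ℤ), by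
    intro h
    have := (vgcd_eq_zero_iff _).2 h
    rw [vgcd_smul, p.2.2] at this
    simp at this⟩
  invFun v := (vgcd v.1 - 1, ⟨primPart v.1, vgcd_primPart v.2⟩)
  left_inv p := by
    obtain ⟨n, w, hw⟩ := p
    have hg : vgcd (((n + 1 : ℕ) : ℤ) • w) = n + 1 := by rw [vgcd_smul, hw, mul_one]
    simp only [hg, Nat.add_sub_cancel]
    congr 1
    apply Subtype.ext
    ext i
    simp only [primPart, hg, Pi.smul_apply, smul_eq_mul]
    rw [Int.mul_ediv_cancel_left]
    exact_mod_cast Nat.succ_ne_zero n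
  right_inv v := by
    obtain ⟨v, hv⟩ := v
    apply Subtype.ext
    have hg : vgcd v ≠ 0 := fun h0 => hv ((vgcd_eq_zero_iff v).1 h0)
    simp only [Nat.sub_add_cancel (Nat.pos_of_ne_zero hg)]
    exact vgcd_smul_primPart v

/-- `gcdEquiv (n, w) = (n + 1) w`. [folklore] -/
theorem gcdEquiv_apply (n : ℕ) (w : Prim) :
    ((gcdEquiv (n, w) : {v : Fin 2 ⊕ Fin 2 → ℤ // v ≠ 0}) : Fin 2 ⊕ Fin 2 → ℤ) =
      ((n + 1 : ℕ) : ℤ) • (w : Fin 2 ⊕ Fin 2 → ℤ) := rfl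

open scoped ENNReal in
/-- **Rearranging a sum over `ℤ⁴ ∖ 0` by the gcd**:
`Σ_{v ≠ 0} F(v) = Σ_{n ≥ 0} Σ_{w primitive} F((n+1) w)` in `ℝ≥0∞`. [folklore] -/
theorem tsum_ne_zero_eq_tsum_prim (F : (Fin 2 ⊕ Fin 2 → ℤ) → ℝ≥0∞) :
    ∑' v : {v : Fin 2 ⊕ Fin 2 → ℤ // v ≠ 0}, F v =
      ∑' n : ℕ, ∑' w : Prim, F (((n + 1 : ℕ) : ℤ) • (w : Fin 2 ⊕ Fin 2 → ℤ)) := by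
  rw [← gcdEquiv.tsum_eq, ENNReal.tsum_prod']
  rfl

open scoped ENNReal in
/-- Splitting off `v = 0`: `Σ_v F(v) = F(0) + Σ_{v ≠ 0} F(v)` in `ℝ≥0∞`. [folklore] -/
theorem tsum_eq_zero_add_tsum_ne_zero (F : (Fin 2 ⊕ Fin 2 → ℤ) → ℝ≥0∞) :
    ∑' v : Fin 2 ⊕ Fin 2 → ℤ, F v = F 0 + ∑' v : {v : Fin 2 ⊕ Fin 2 → ℤ // v ≠ 0}, F v := by
  rw [← ENNReal.summable.tsum_add_tsum_compl (s := ({0} : Set (Fin 2 ⊕ Fin 2 → ℤ)))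
    ENNReal.summable, tsum_singleton]
  rfl

end Literature.NumberTheory.ModularForms.Sp4Covolume
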